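import Mathlib.Analysis.SpecialFunctions.SmoothTransition
import Mathlib.Analysis.InnerProductSpace.Calculus
import Literature.Geometry.Lorentzian.PositiveMassRigidity
import Literature.Geometry.Lorentzian.HypersurfaceRestriction
import Literature.Geometry.Lorentzian.GeodesicConfinement
import HarnessLib

/-!
# Asymptotically flat data with one end are complete (discharge of `isComplete_of_isSoleEnd`)

This file discharges the folklore named fact
`Literature.Geometry.Lorentzian.isComplete_of_isSoleEnd` of `PositiveMassRigidity.lean` (step 4a
of the Schoen–Yau rigidity DAG): *if the metric `h` of an initial data set on a `3`-manifold `X`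
satisfies, in the chart of an end `e`, `h - (1 + 2M/r) δ = o(r^{-β})` with `β ≥ 0` (any strong
decay class `IsStronglyAsymptoticallyFlatWith e D M β γ nh nk`), and the complement of a far
region of `e` is compact (`e.IsSoleEnd`), then `(X, h)` is geodesically complete*
(`isComplete_of_isSoleEnd_holds`). In print this is implicit in Schoen–Yau, Comm. Math. Phys. 65
(1979), §1 and p. 63, where asymptotic flatness is defined through a compact `K` with `N ∖ K` a
union of ends and completeness is used without comment; the textbook statement is the
Hopf–Rinow theorem (O'Neill 1983, Ch. 5, Thm. 21; Gallot–Hulin–Lafontaine 2004, Thm. 2.103).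

## Proof

Instead of Hopf–Rinow we use **Gordon's criterion** (Gordon, Proc. AMS 37 (1973), Theorem),
proved in `GeodesicConfinement.lean` in the form: a positive definite `C^∞` metric on a locally
compact Hausdorff manifold without boundary carrying a differentiable function `ρ` with
`|dρ(v)| ≤ L |v|_h` and relatively compact sublevel sets has geodesically complete Levi-Civita
connection. The function is the smoothed coordinate radius of the end:

* `exists_radius_norm_sq_le`: from the order-zero decay `h_ij - (1 + 2M/r) δ_ij → 0` one gets
  `R₁` with `‖w‖² ≤ 2 h_ij(y) wⁱ wʲ` for `‖y‖ ≥ R₁` (the chart norm is dominated by `h` far out);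
* `exists_cutoff`: a `C¹`, `L₀`-Lipschitz profile `Θ : E3 → ℝ` vanishing on `‖y‖ ≤ R₁ + 1`
  with `Θ y ≥ ‖y‖ - R₁ - 2` (built from Mathlib's `Real.smoothTransition`);
* `ρ q = Θ (chart q)` on the end, `ρ = 0` elsewhere, is `C¹` on `X` (it vanishes near the edge
  of the end, the sets `chart⁻¹ {r ≥ R'}` being closed in `X`, `AFEnd.isClosed_far`), with
  `|dρ_q(v)| = |dΘ(dchart v)| ≤ L₀ ‖dchart v‖ ≤ L₀ √2 |v|_h` by the pullback identity
  `h_ij(chart q) (dchart v)ⁱ (dchart v)ʲ = h_q(v, v)` (`hCoeff_chart_apply_mfderiv`);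
* `exists_isCompact_compl_far_subset`: `X ∖ far R₂` is contained in the compact set
  `(X ∖ far R') ∪ chart⁻¹ {R' ≤ r ≤ R₂}` (`IsSoleEnd`), and `{ρ ≤ s} ⊆ X ∖ far (R₁ + 2 + s)`.

Consequently the reduction of `positive_mass_rigidity` to its research-level sources loses the
completeness leaf: `positive_mass_rigidity_of_source_facts''''` (Schoen–Yau Thm. 1, Cor. 3.1,
the Ricci variation (3.24)–(3.30), and Greene–Wu's Thm. A imply `positive_mass_rigidity`).

## References

* W. B. Gordon, *An analytical criterion for the completeness of Riemannian manifolds*, Proc.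
  Amer. Math. Soc. 37 (1973) 221–225, Theorem.
* R. Schoen, S.-T. Yau, *On the proof of the positive mass conjecture in general relativity*,
  Comm. Math. Phys. 65 (1979) 45–76, §1 (p. 47) and §3 (p. 63).
* B. O'Neill, *Semi-Riemannian geometry with applications to relativity*, Academic Press 1983,
  Ch. 5, Thm. 21 (Hopf–Rinow), for the classical route not taken here.
-/

noncomputable section

open Bundle Set Filter Metric Asymptotics
open scoped Manifold ContDiff Topology NNReal

namespace Literature.Geometry.Lorentzian

namespace AFEnd

variable {X : Type} [TopologicalSpace X] [ChartedSpace E3 X] [IsManifold (𝓡 3) ∞ X]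
  (e : AFEnd X) (D : InitialDataSet (𝓡 3) X)

/-! ### The chart of the end and the metric -/

/-- On the exterior region the chart components of the metric are the pullback of `h` along the
inverse chart (the `dif` of `AFEnd.hCoeff` resolved at a point of the subtype). Bartnik 1986,
(1.3). [cite: Bartnik1986, (1.3)] -/
theorem hCoeff_coe (z : exteriorRegion e.R) :
    hCoeff e D (z : E3) = pullbackBilin (I := 𝓡 3) (I' := 𝓡 3) e.dataChart D.h.inner z := by
  have h : e.R < ‖(z : E3)‖ := z.2
  unfold hCoeff
  rw [dif_pos h]

omit [IsManifold (𝓡 3) ∞ X] in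
/-- The inverse chart undoes the chart: `Φ (chart q) = q`. Bartnik 1986, §1.
[cite: Bartnik1986, §1] -/
theorem dataChart_chart (q : e.U) : e.dataChart (e.chart q) = (q : X) := by
  simp [dataChart]

omit [IsManifold (𝓡 3) ∞ X] in
/-- The differential of the inverse chart undoes the differential of the chart:
`dΦ_{chart q} (dchart_q v) = v` (chain rule for `Φ ∘ chart = ι`, the inclusion of the open end,
whose differential is the identity, `mfderiv_subtypeVal`). Bartnik 1986, §1.
[cite: Bartnik1986, §1] -/
theorem mfderiv_dataChart_mfderiv_chart (q : e.U) (v : TangentSpace (𝓡 3) q) :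
    mfderiv (𝓡 3) (𝓡 3) e.dataChart (e.chart q) (mfderiv (𝓡 3) (𝓡 3) e.chart q v) = v := by
  have hc : MDifferentiableAt (𝓡 3) (𝓡 3) e.chart q :=
    e.chart.contMDiff.mdifferentiableAt (by simp)
  have hd : MDifferentiableAt (𝓡 3) (𝓡 3) e.dataChart (e.chart q) :=
    (e.contMDiff_dataChart _).mdifferentiableAt (by simp)
  have h4 : mfderiv (𝓡 3) (𝓡 3) (e.dataChart ∘ e.chart) q =
      (mfderiv (𝓡 3) (𝓡 3) e.dataChart (e.chart q)).comp (mfderiv (𝓡 3) (𝓡 3) e.chart q) :=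
    mfderiv_comp q hd hc
  have h5 : e.dataChart ∘ e.chart = (Subtype.val : e.U → X) := by
    ext q'
    simp [dataChart]
  rw [h5, mfderiv_subtypeVal] at h4
  exact (DFunLike.congr_fun h4 v).symm

/-- **The chart components evaluate the metric**: for a point `q` of the end and a tangent
vector `v` at `q`, `h_ij(chart q) (dchart v)ⁱ (dchart v)ʲ = h_q(v, v)` — the defining property
of the chart components `h_ij = (Φ^* h)_ij` (Bartnik 1986, (1.3)) read backwards through
`dΦ ∘ dchart = id`. [cite: Bartnik1986, (1.3)] -/
theorem hCoeff_chart_apply_mfderiv (q : e.U) (v : TangentSpace (𝓡 3) q) :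
    hCoeff e D (e.chart q : E3) (mfderiv (𝓡 3) (𝓡 3) e.chart q v)
      (mfderiv (𝓡 3) (𝓡 3) e.chart q v) = D.h.inner (q : X) v v := by
  rw [hCoeff_coe]
  have key : ∀ (a : X) (_ : a = (q : X)) (w : E3) (_ : w = v),
      D.h.inner a w w = D.h.inner (q : X) v v := by
    rintro a rfl w rfl
    rfl
  exact key _ (e.dataChart_chart q) _ (e.mfderiv_dataChart_mfderiv_chart q v)

/-! ### Order-zero decay: the chart norm is dominated by the metric far out -/

-- the operator norm on `E3 →L[ℝ] E3 →L[ℝ] ℝ` is slow to synthesize through `PiLp`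
set_option synthInstance.maxHeartbeats 80000 in
variable {e D} in
/-- **Far out, the coordinate norm is controlled by the metric.** If
`h_ij - (1 + 2M/r) δ_ij = o(r^{-β})` in the chart of the end with `β ≥ 0` (the order-zero clause
of `IsStronglyAsymptoticallyFlatWith e D M β γ nh nk`), then there is `R₁ > R` (`R₁ > 0`) such
that `‖w‖² ≤ 2 h_ij(y) wⁱ wʲ` for all `‖y‖ ≥ R₁` and `w ∈ ℝ³`: for large `r` the operator norm
of `h(y) - (1 + 2M/r) δ` is at most `1/4` and `|2M/r| ≤ 1/4`, so `h(y)(w, w) ≥ ‖w‖²/2`. (The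
uniform equivalence of `ds²` with the Euclidean metric on the end, Schoen–Yau 1979, p. 63.)
[cite: SchoenYauPMT1979, §3 p. 63] -/
theorem exists_radius_norm_sq_le {M β γ : ℝ} {nh nk : ℕ} (hβ : 0 ≤ β)
    (h : e.IsStronglyAsymptoticallyFlatWith D M β γ nh nk) :
    ∃ R₁ : ℝ, e.R < R₁ ∧ 0 < R₁ ∧
      ∀ y : E3, R₁ ≤ ‖y‖ → ∀ w : E3, ‖w‖ ^ 2 ≤ 2 * hCoeff e D y w w := by
  have h0 := h.1 0 (Nat.zero_le _)
  have h1 : ∀ᶠ y in Bornology.cobounded E3,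
      ‖hCoeff e D y - (1 + 2 * M / ‖y‖) • (innerSL ℝ : E3 →L[ℝ] E3 →L[ℝ] ℝ)‖ ≤ 1 / 4 := by
    filter_upwards [h0.def (show (0 : ℝ) < 1 / 4 by norm_num),
      eventually_cobounded_le_norm (E := E3) 1] with y hy hy1
    rw [norm_iteratedFDeriv_zero, norm_norm] at hy
    refine hy.trans ?_
    have h2 : ‖y‖ ^ (-β - ((0 : ℕ) : ℝ)) ≤ 1 := by
      rw [Nat.cast_zero, sub_zero]
      exact Real.rpow_le_one_of_one_le_of_nonpos hy1 (by linarith)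
    rw [Real.norm_of_nonneg (Real.rpow_nonneg (norm_nonneg _) _)]
    calc 1 / 4 * ‖y‖ ^ (-β - ((0 : ℕ) : ℝ)) ≤ 1 / 4 * 1 := mul_le_mul_of_nonneg_left h2 (by norm_num)
      _ = 1 / 4 := by norm_num
  have h3 : ∀ᶠ y in Bornology.cobounded E3, |2 * M / ‖y‖| ≤ 1 / 4 := by
    filter_upwards [eventually_cobounded_le_norm (E := E3) (8 * |M| + 1)] with y hy
    have hypos : 0 < ‖y‖ := by linarith [abs_nonneg M]
    rw [abs_div, abs_norm, div_le_iff₀ hypos, abs_mul, abs_two]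
    nlinarith [abs_nonneg M]
  obtain ⟨r, -, hr⟩ := (Filter.hasBasis_cobounded_norm (E := E3)).eventually_iff.1 (h1.and h3)
  refine ⟨max r (e.R + 1), lt_of_lt_of_le (by linarith) (le_max_right _ _),
    lt_of_lt_of_le (by linarith [e.R_pos]) (le_max_right _ _), fun y hy w ↦ ?_⟩
  obtain ⟨hA, hM⟩ := hr (show r ≤ ‖y‖ from (le_max_left _ _).trans hy)
  set A := hCoeff e D y - (1 + 2 * M / ‖y‖) • (innerSL ℝ : E3 →L[ℝ] E3 →L[ℝ] ℝ) with hA_def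
  have hδ : (innerSL ℝ : E3 →L[ℝ] E3 →L[ℝ] ℝ) w w = ‖w‖ ^ 2 := by
    rw [← real_inner_self_eq_norm_sq]
    rfl
  have hdec : hCoeff e D y w w = A w w + (1 + 2 * M / ‖y‖) * ‖w‖ ^ 2 := by
    simp only [hA_def, sub_apply, smul_apply, smul_eq_mul, hδ]
    ring
  have hAw : |A w w| ≤ 1 / 4 * ‖w‖ ^ 2 := by
    rw [← Real.norm_eq_abs]
    calc ‖A w w‖ ≤ ‖A‖ * ‖w‖ * ‖w‖ := A.le_opNorm₂ w w
      _ ≤ 1 / 4 * ‖w‖ * ‖w‖ := by gcongr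
      _ = 1 / 4 * ‖w‖ ^ 2 := by ring
  have hM' : 3 / 4 ≤ 1 + 2 * M / ‖y‖ := by linarith [(abs_le.1 hM).1]
  rw [hdec]
  nlinarith [(abs_le.1 hAw).1, sq_nonneg ‖w‖]

/-! ### A smooth radial cutoff -/

/-- **A smoothed radius.** For `R₁ > 0` there are a `C¹` function `Θ : ℝ³ → ℝ` and `L₀ ≥ 0` with
`Θ` `L₀`-Lipschitz, `Θ = 0` on the closed ball of radius `R₁ + 1`, and `Θ(y) ≥ ‖y‖ - R₁ - 2`:
`Θ(y) = ψ(‖y‖)` with `ψ(r) = S(r - R₁ - 1) · (r - R₁ - 1)`, `S` Mathlib's smooth transition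
(`Real.smoothTransition`, `0` on `r ≤ 0`, `1` on `r ≥ 1`); `ψ'` is bounded (by compactness of
`[0, 1]`, outside of which `S` is locally constant), so `ψ` and `Θ` are Lipschitz, and the norm is
smooth away from the origin. [folklore] -/
theorem exists_cutoff (R₁ : ℝ) (hR₁ : 0 < R₁) :
    ∃ (Θ : E3 → ℝ) (L₀ : ℝ≥0), ContDiff ℝ 1 Θ ∧ LipschitzWith L₀ Θ ∧
      (∀ y : E3, ‖y‖ ≤ R₁ + 1 → Θ y = 0) ∧ ∀ y : E3, ‖y‖ - R₁ - 2 ≤ Θ y := by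
  set S := Real.smoothTransition with hS_def
  set ψ : ℝ → ℝ := fun r ↦ S (r - R₁ - 1) * (r - R₁ - 1) with hψ_def
  have hSd : ContDiff ℝ 1 S := Real.smoothTransition.contDiff
  have hlin : ContDiff ℝ 1 fun r : ℝ ↦ r - R₁ - 1 := (contDiff_id.sub contDiff_const).sub contDiff_const
  have hψd : ContDiff ℝ 1 ψ := (hSd.comp hlin).mul hlin
  -- `S'` vanishes off `[0, 1]` and is bounded on `[0, 1]`
  have hS'neg : ∀ u : ℝ, u < 0 → deriv S u = 0 := by
    intro u hu
    have h : S =ᶠ[𝓝 u] fun _ ↦ 0 :=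
      Filter.eventuallyEq_of_mem (Iio_mem_nhds hu)
        fun u' hu' ↦ Real.smoothTransition.zero_of_nonpos (le_of_lt hu')
    rw [h.deriv_eq, deriv_const]
  have hS'one : ∀ u : ℝ, 1 < u → deriv S u = 0 := by
    intro u hu
    have h : S =ᶠ[𝓝 u] fun _ ↦ 1 :=
      Filter.eventuallyEq_of_mem (Ioi_mem_nhds hu)
        fun u' hu' ↦ Real.smoothTransition.one_of_one_le (le_of_lt hu')
    rw [h.deriv_eq, deriv_const]
  obtain ⟨B, hB⟩ : ∃ B, ∀ u ∈ Icc (0 : ℝ) 1, ‖deriv S u‖ ≤ B :=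
    isCompact_Icc.exists_bound_of_continuousOn (hSd.continuous_deriv le_rfl).continuousOn
  -- the derivative of `ψ` is bounded by `L₀ = max B 0 + 1`
  set L₀ : ℝ≥0 := (max B 0 + 1).toNNReal with hL₀_def
  have hL₀c : (L₀ : ℝ) = max B 0 + 1 := Real.coe_toNNReal _ (by positivity)
  have hψ' : ∀ r, HasDerivAt ψ (deriv S (r - R₁ - 1) * 1 * (r - R₁ - 1) + S (r - R₁ - 1) * 1) r := by
    intro r
    have h1 : HasDerivAt (fun r : ℝ ↦ r - R₁ - 1) 1 r := ((hasDerivAt_id r).sub_const R₁).sub_const 1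
    have h2 : HasDerivAt (fun r ↦ S (r - R₁ - 1)) (deriv S (r - R₁ - 1) * 1) r :=
      (hSd.differentiable one_ne_zero _).hasDerivAt.comp r h1
    exact h2.mul h1
  have hψ'bd : ∀ r, ‖deriv ψ r‖₊ ≤ L₀ := by
    intro r
    rw [(hψ' r).deriv, ← NNReal.coe_le_coe, coe_nnnorm, hL₀c, Real.norm_eq_abs, mul_one, mul_one]
    set u := r - R₁ - 1 with hu_def
    have hS0 : 0 ≤ S u := Real.smoothTransition.nonneg u
    have hS1 : S u ≤ 1 := Real.smoothTransition.le_one u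
    rcases lt_or_ge u 0 with hu | hu
    · rw [hS'neg u hu, zero_mul, zero_add, abs_of_nonneg hS0]
      linarith [le_max_right B 0]
    · by_cases hu1 : u ≤ 1
      · have hb := hB u ⟨hu, hu1⟩
        rw [Real.norm_eq_abs] at hb
        calc |deriv S u * u + S u| ≤ |deriv S u * u| + |S u| := abs_add_le _ _
          _ = |deriv S u| * |u| + S u := by rw [abs_mul, abs_of_nonneg hS0]
          _ ≤ B * 1 + 1 := by
            gcongr
            · exact (abs_nonneg _).trans hb
            · rw [abs_of_nonneg hu]
              exact hu1
          _ ≤ max B 0 + 1 := by linarith [le_max_left B 0]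
      · rw [hS'one u (lt_of_not_ge hu1), zero_mul, zero_add, abs_of_nonneg hS0]
        linarith [le_max_right B 0]
  have hψLip : LipschitzWith L₀ ψ :=
    lipschitzWith_of_nnnorm_deriv_le (hψd.differentiable one_ne_zero) hψ'bd
  -- the cutoff vanishes for `r ≤ R₁ + 1` and grows linearly
  have hψ0 : ∀ r ≤ R₁ + 1, ψ r = 0 := fun r hr ↦ by
    simp only [hψ_def, hS_def, Real.smoothTransition.zero_of_nonpos (show r - R₁ - 1 ≤ 0 by linarith),
      zero_mul]
  have hψge : ∀ r, r - R₁ - 2 ≤ ψ r := by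
    intro r
    simp only [hψ_def]
    by_cases h1 : 1 ≤ r - R₁ - 1
    · rw [hS_def, Real.smoothTransition.one_of_one_le h1, one_mul]
      linarith
    · have : 0 ≤ S (r - R₁ - 1) * (r - R₁ - 1) ∨ r - R₁ - 1 ≤ 0 := by
        by_cases h2 : 0 ≤ r - R₁ - 1
        · exact Or.inl (mul_nonneg (Real.smoothTransition.nonneg _) h2)
        · exact Or.inr (le_of_not_ge h2)
      rcases this with h3 | h3
      · linarith
      · rw [hS_def, Real.smoothTransition.zero_of_nonpos h3, zero_mul]
        linarith
  -- the radial function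
  refine ⟨fun y ↦ ψ ‖y‖, L₀, ?_, ?_, fun y hy ↦ hψ0 _ hy, fun y ↦ hψge _⟩
  · rw [contDiff_iff_contDiffAt]
    intro y
    by_cases hy : ‖y‖ < R₁ + 1
    · have h : (fun y : E3 ↦ ψ ‖y‖) =ᶠ[𝓝 y] fun _ ↦ 0 := by
        filter_upwards [(isOpen_lt continuous_norm continuous_const).mem_nhds hy] with y' hy'
        exact hψ0 _ (le_of_lt hy')
      exact contDiffAt_const.congr_of_eventuallyEq h
    · have hy0 : y ≠ 0 := by
        intro h0
        rw [h0, norm_zero] at hy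
        linarith
      exact hψd.contDiffAt.comp y (contDiffAt_norm ℝ hy0)
  · exact (hψLip.comp lipschitzWith_one_norm).weaken (by simp)

/-! ### Compactness modulo the end -/

omit [IsManifold (𝓡 3) ∞ X] in
/-- **The complement of every far region is contained in a compact set** when the end is the only
one (`IsSoleEnd`: `X ∖ far R'` compact for some `R' > R`): `X ∖ far R₂ ⊆ (X ∖ far R') ∪
Φ({R' ≤ ‖y‖ ≤ R₂})`, the second set being the continuous image of a compact annulus in the
exterior region. This is "`N ∖ N_k` is compact" of Schoen–Yau 1979, p. 63, for the far regions of
the end. [cite: SchoenYauPMT1979, §3 p. 63] -/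
theorem exists_isCompact_compl_far_subset {e : AFEnd X} (h : e.IsSoleEnd) (R₂ : ℝ) :
    ∃ K : Set X, IsCompact K ∧ (e.far R₂)ᶜ ⊆ K := by
  obtain ⟨R', hR', hK'⟩ := h
  set B : Set E3 := {y | R' ≤ ‖y‖} ∩ closedBall (0 : E3) R₂ with hB_def
  have hBc : IsCompact B :=
    (isCompact_closedBall 0 R₂).inter_left (isClosed_le continuous_const continuous_norm)
  set B' : Set (exteriorRegion e.R) := Subtype.val ⁻¹' B with hB'_def
  have hsub : B ⊆ range (Subtype.val : exteriorRegion e.R → E3) := fun y hy ↦ by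
    rw [Subtype.range_coe_subtype]
    exact mem_exteriorRegion.2 (lt_of_lt_of_le hR' hy.1)
  have hB'c : IsCompact B' := by
    rw [Topology.IsEmbedding.subtypeVal.isCompact_iff, image_preimage_eq_inter_range,
      inter_eq_left.2 hsub]
    exact hBc
  refine ⟨(e.far R')ᶜ ∪ e.dataChart '' B',
    hK'.union (hB'c.image e.contMDiff_dataChart.continuous), fun q hq ↦ ?_⟩
  by_cases hq' : q ∈ e.far R'
  · obtain ⟨z, hz, rfl⟩ := hq'
    have hz' : R' < ‖(e.chart z : E3)‖ := hz
    have hz2 : ‖(e.chart z : E3)‖ ≤ R₂ := by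
      by_contra hlt
      exact hq ⟨z, lt_of_not_ge hlt, rfl⟩
    right
    refine ⟨e.chart z, ⟨hz'.le, mem_closedBall_zero_iff.2 hz2⟩, ?_⟩
    simp [dataChart]
  · left
    exact hq'

/-! ### The proper function with `h`-bounded gradient -/

variable {e D} in
/-- **The smoothed coordinate radius of the end is a proper function with `h`-bounded gradient**
(the input to Gordon's criterion; cf. Gordon 1973, p. 222, where the distance function is
smoothed). Under the hypotheses of `isComplete_of_isSoleEnd` there are a function `ρ : X → ℝ`,
differentiable everywhere, and `L ≥ 0` with `|dρ_q(v)| ≤ L √(h_q(v, v))` and every sublevel set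
`{ρ ≤ s}` contained in a compact set: `ρ = Θ ∘ chart` on the end (`exists_cutoff` with the radius
of `exists_radius_norm_sq_le`), extended by `0`; it is `C¹` since it vanishes near the edge of the
end (`isClosed_far`), `|dρ(v)| ≤ L₀ ‖dchart v‖ ≤ L₀ √2 |v|_h` (`hCoeff_chart_apply_mfderiv`), and
`{ρ ≤ s} ⊆ X ∖ far (R₁ + 2 + s)` (`exists_isCompact_compl_far_subset`).
[cite: Gordon1973, Theorem (proof)] -/
theorem exists_properFunction {M β γ : ℝ} {nh nk : ℕ} (hβ : 0 ≤ β)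
    (haf : e.IsStronglyAsymptoticallyFlatWith D M β γ nh nk) (hsole : e.IsSoleEnd) :
    ∃ (ρ : X → ℝ) (L : ℝ), 0 ≤ L ∧ (∀ q, MDifferentiableAt (𝓡 3) 𝓘(ℝ, ℝ) ρ q) ∧
      (∀ (q : X) (v : TangentSpace (𝓡 3) q),
        |mvfderiv (𝓡 3) ρ q v| ≤ L * Real.sqrt (D.metric.val q v v)) ∧
      ∀ s : ℝ, ∃ K : Set X, IsCompact K ∧ ∀ q, ρ q ≤ s → q ∈ K := by
  classical
  obtain ⟨R₁, hR₁, hR₁0, hnorm⟩ := exists_radius_norm_sq_le hβ haf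
  obtain ⟨Θ, L₀, hΘd, hΘL, hΘ0, hΘge⟩ := exists_cutoff R₁ hR₁0
  -- the function
  set ρ : X → ℝ := fun q ↦ if hq : q ∈ e.U then Θ (e.chart ⟨q, hq⟩ : E3) else 0 with hρ_def
  set Ψ : e.U → E3 := fun q ↦ (e.chart q : E3) with hΨ_def
  have hρU : ∀ q : e.U, ρ q = Θ (Ψ q) := fun q ↦ by
    simp only [hρ_def, dif_pos q.2, hΨ_def]
  have hρval : (fun q : e.U ↦ ρ q) = Θ ∘ Ψ := funext hρU
  -- it vanishes on the open set where the coordinate radius is `< R₁ + 1/2` (or off the end)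
  set C₁ : Set X := ((↑) : e.U → X) '' (e.chart ⁻¹' {x | R₁ + 1 / 2 ≤ ‖(x : E3)‖}) with hC₁_def
  have hC₁ : IsClosed C₁ := e.isClosed_far _ (by linarith)
  have hρC : ∀ q ∈ C₁ᶜ, ρ q = 0 := by
    intro q hq
    by_cases hqU : q ∈ e.U
    · have hlt : ‖(e.chart ⟨q, hqU⟩ : E3)‖ < R₁ + 1 / 2 := by
        by_contra hle
        exact hq ⟨⟨q, hqU⟩, le_of_not_gt hle, rfl⟩
      rw [hρU ⟨q, hqU⟩]
      exact hΘ0 _ (by simp only [hΨ_def]; linarith)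
    · simp only [hρ_def, dif_neg hqU]
  have hρC' : ∀ q ∈ C₁ᶜ, ρ =ᶠ[𝓝 q] fun _ ↦ 0 := fun q hq ↦
    Filter.eventuallyEq_of_mem (hC₁.isOpen_compl.mem_nhds hq) hρC
  -- smoothness
  have hΨd : ContMDiff (𝓡 3) 𝓘(ℝ, E3) 1 Ψ :=
    (contMDiff_subtype_val.comp e.chart.contMDiff).of_le (by simp)
  have hρval_d : ContMDiff (𝓡 3) 𝓘(ℝ, ℝ) 1 (fun q : e.U ↦ ρ q) := by
    rw [hρval]
    exact hΘd.contMDiff.comp hΨd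
  have hρd1 : ∀ q, ContMDiffAt (𝓡 3) 𝓘(ℝ, ℝ) 1 ρ q := by
    intro q
    by_cases hq : q ∈ C₁
    · obtain ⟨z, -, rfl⟩ := hq
      exact contMDiffAt_subtype_iff.1 (hρval_d z)
    · exact contMDiffAt_const.congr_of_eventuallyEq (hρC' q hq)
  have hρd : ∀ q, MDifferentiableAt (𝓡 3) 𝓘(ℝ, ℝ) ρ q := fun q ↦
    (hρd1 q).mdifferentiableAt one_ne_zero
  -- the gradient bound
  have hL₀ : ∀ y, ‖fderiv ℝ Θ y‖ ≤ L₀ := fun y ↦ norm_fderiv_le_of_lipschitz ℝ hΘL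
  refine ⟨ρ, L₀ * Real.sqrt 2, by positivity, hρd, fun q v ↦ ?_, fun s ↦ ?_⟩
  · by_cases hq : q ∈ C₁
    · obtain ⟨z, hz, rfl⟩ := hq
      have hz' : R₁ + 1 / 2 ≤ ‖Ψ z‖ := hz
      -- `dρ(v) = dΘ (dΨ v)` and `dΨ v = dchart v`
      have hΨz : MDifferentiableAt (𝓡 3) 𝓘(ℝ, E3) Ψ z := (hΨd z).mdifferentiableAt one_ne_zero
      have hΘz : MDifferentiableAt 𝓘(ℝ, E3) 𝓘(ℝ, ℝ) Θ (Ψ z) :=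
        (hΘd.contMDiff (Ψ z)).mdifferentiableAt one_ne_zero
      have hw : mfderiv (𝓡 3) 𝓘(ℝ, E3) Ψ z v = mfderiv (𝓡 3) (𝓡 3) e.chart z v := by
        have hc : MDifferentiableAt (𝓡 3) (𝓡 3) e.chart z :=
          e.chart.contMDiff.mdifferentiableAt (by simp)
        have h1 : mfderiv (𝓡 3) 𝓘(ℝ, E3) Ψ z =
            (mfderiv (𝓡 3) (𝓡 3) (Subtype.val : exteriorRegion e.R → E3) (e.chart z)).comp
              (mfderiv (𝓡 3) (𝓡 3) e.chart z) :=
          mfderiv_comp z (hasMFDerivAt_subtypeVal (e.chart z)).mdifferentiableAt hc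
        rw [h1, mfderiv_subtypeVal]
        rfl
      have hmv : mvfderiv (𝓡 3) ρ (z : X) v =
          fderiv ℝ Θ (Ψ z) (mfderiv (𝓡 3) (𝓡 3) e.chart z v) := by
        show mfderiv (𝓡 3) 𝓘(ℝ, ℝ) ρ (z : X) v = _
        rw [← mfderiv_comp_subtypeVal (hρd z), show (ρ ∘ Subtype.val : e.U → ℝ) = Θ ∘ Ψ from hρval,
          mfderiv_comp z hΘz hΨz, mfderiv_eq_fderiv]
        exact congrArg (fderiv ℝ Θ (Ψ z)) hw
      set w : E3 := mfderiv (𝓡 3) (𝓡 3) e.chart z v with hw_def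
      have h1 : |fderiv ℝ Θ (Ψ z) w| ≤ L₀ * ‖w‖ := by
        rw [← Real.norm_eq_abs]
        exact (ContinuousLinearMap.le_opNorm _ _).trans (mul_le_mul_of_nonneg_right (hL₀ _) (norm_nonneg _))
      have h2 : ‖w‖ ^ 2 ≤ 2 * D.metric.val (z : X) v v := by
        have h3 := hnorm (Ψ z) (by linarith) w
        rwa [hw_def, hCoeff_chart_apply_mfderiv] at h3
      have h4 : ‖w‖ ≤ Real.sqrt 2 * Real.sqrt (D.metric.val (z : X) v v) := by
        rw [← Real.sqrt_mul zero_le_two, ← Real.sqrt_sq (norm_nonneg w)]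
        exact Real.sqrt_le_sqrt h2
      rw [hmv]
      calc |fderiv ℝ Θ (Ψ z) w| ≤ L₀ * ‖w‖ := h1
        _ ≤ L₀ * (Real.sqrt 2 * Real.sqrt (D.metric.val (z : X) v v)) := by gcongr
        _ = L₀ * Real.sqrt 2 * Real.sqrt (D.metric.val (z : X) v v) := by ring
    · rw [mvfderiv_congr_of_eventuallyEq (hρC' q hq), mvfderiv_const]
      simp only [zero_apply, abs_zero]
      positivity
  · obtain ⟨K, hK, hKsub⟩ := exists_isCompact_compl_far_subset hsole (R₁ + 2 + s)
    refine ⟨K, hK, fun q hq ↦ hKsub fun hfar ↦ ?_⟩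
    obtain ⟨z, hz, rfl⟩ := hfar
    have hz' : R₁ + 2 + s < ‖Ψ z‖ := hz
    have h1 := hΘge (Ψ z)
    rw [← hρU z] at h1
    have : ρ (z : X) ≤ s := hq
    linarith

end AFEnd

/-! ### The discharge -/

/-- **Asymptotically flat data with one end are complete** (discharge of the named fact
`isComplete_of_isSoleEnd` of `PositiveMassRigidity.lean`; folklore, implicit in Schoen–Yau 1979,
§1 and p. 63; classically via the Hopf–Rinow theorem, O'Neill 1983, Ch. 5, Thm. 21). Proof by
Gordon's criterion (`PseudoRiemannianMetric.isGeodesicallyComplete_of_properFunction`, Gordon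
1973) applied to the smoothed coordinate radius of the end (`AFEnd.exists_properFunction`): `X`
is locally compact (charts in `ℝ³`), Hausdorff and boundaryless, `h` is positive definite and
smooth, and its Levi-Civita connection is the one of `InitialDataSet.IsComplete`.
[cite: Gordon1973, Theorem] -/
theorem isComplete_of_isSoleEnd_holds : isComplete_of_isSoleEnd := by
  intro X _ _ _ _ _ _ D _ e M β γ nh nk hβ haf hsole
  haveI : LocallyCompactSpace X := ChartedSpace.locallyCompactSpace E3 X
  obtain ⟨ρ, L, hL, hρd, hdρ, hproper⟩ := AFEnd.exists_properFunction hβ haf hsole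
  exact D.metric.isGeodesicallyComplete_of_properFunction (WithTop.coe_le_coe.2 le_top)
    D.isRiemannian_metric hL hρd hdρ
    hproper

/-- **Reduction of positive mass rigidity to the research-level sources, completeness
discharged.** As `positive_mass_rigidity_of_source_facts'''` (`PositiveMassRigidity.lean`), with
step 4a (`isComplete_of_isSoleEnd`) now proved (`isComplete_of_isSoleEnd_holds`). The remaining
leaves of the DAG below `positive_mass_rigidity` are Schoen–Yau's Thm. 1
(`schoenYau_mass_nonneg`), Cor. 3.1 (`exists_conformal_negativeMass_of_massZero`), the Ricci
variation (3.24)–(3.30) (`exists_ricciVariation_negativeMass_of_massZero`) and Greene–Wu's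
Thm. A (`euclidean_of_isFlat_of_isSoleEnd`). [cite: SchoenYauPMT1979, Thm. 2 (p. 48) and §3] -/
theorem positive_mass_rigidity_of_source_facts'''' (h₀ : schoenYau_mass_nonneg)
    (hc : exists_conformal_negativeMass_of_massZero)
    (hv : exists_ricciVariation_negativeMass_of_massZero)
    (h₅ : euclidean_of_isFlat_of_isSoleEnd) : positive_mass_rigidity :=
  positive_mass_rigidity_of_source_facts''' h₀ hc hv isComplete_of_isSoleEnd_holds h₅

end Literature.Geometry.Lorentzian

end
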